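import Summits.QuantumFields.BalabanUV.Beta.GAN24.ExchangeE2E2ChannelTools
import Summits.QuantumFields.BalabanUV.Beta.GAN24.ValueHessianCellAdjoint

/-!
# `BalabanUV.Beta.GAN24.ExchangeE2E2ChannelValue` — binder row G-an2-4 ∕ (CONV-C), W-slot (α-0), ROW (C) AT LEVELS `j ≥ 1`, step (W6)(5)–(6) of the (γ) hand's memo
# `HOME/b2b-balaban-gan24-formalise-leaf-06/g52/C-LEVELS-GE1.md` §19: **THE VALUE OF THE E2–X̃–E2 CHANNEL ON THE `Lc`-CELL — for `Lc`-periodic bounded field-leg profiles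
# `qL`, `qR` with `contourSum Lc qR = 0`, `Σ_{x∈cell} Σ_a (E2ᵀ qL)(a,x)·(X̃_{ff}(E2 qR))(a,x) = sf²·wVH⁻¹·Σ_{x∈cell} Σ_b qL(b,x)·(E2 qR)(b,x)`** — every `j`, in-block root,
# every `d`, `Lc ≥ 1` (G-an2-4 CRUX TEAM (2), seat `b2b-balaban-gan24-formalise-leaf-06` = the (γ) hand, gen 52; journal INTENT I-leaf06-g52-9)

NOT IN PRINT; OUR BOOKKEEPING ([folklore] BY NAME: this lineage's (W6)-a `ValueHessianCellAdjoint.sum_box_E2apply_mul_periodic'` (cell adjointness), L4′-through-units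
`ExchangeE2E2ChannelTools.tsum_E2_unitK_E2_apply_of_contourSum_eq_zero`, `dressedStep_apply_periodic`, L4′ `StepCovarianceSandwichApply.abs_apply_bdd_le`; 0 `def`, 0 cited
fact, 0 `def … : Prop`, 0 sorry).
HONEST FRAMING (cell contract, verbatim): «discharging `BetaPertH` makes Bałaban's UV stability UNCONDITIONAL — a real constructive-QFT result; it is NOT the continuum
limit and NOT the Clay problem.»  HONEST DEPENDENCY (verbatim): «continuum YM on T⁴ ⇐ BetaPertH ∧ nine spine estimates (0/9 proved); BetaPertH ⇐ (D1) ∧ (D4) ∧ CAP+tail;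
G-an2-4 gates asym, D1 and NE2/3/4.»
* §1 `tsum_E2_apply_translate`, `exists_abs_E2_apply_le`, `tsum_unitK_apply_eq`, `exists_abs_unitK_apply_le` — the value Hessian and the dressed step kernel on periodic ∕ bounded
  field-leg data (periodicity, uniform bounds).
* §2 **`sum_box_E2T_mul_dressedStep_E2_apply`** — the channel value above (cell adjointness + the sandwich through the units).
* §3 `sawFace_translate`, `abs_sawFace_le`, **`contourSum_csawFace_eq_zero`**, `sum_mul_ite_leg`, `sum_ite_mul_leg`, **`sum_box_channel_sawFace`** — §2 on the
  «sawtooth × exit-face» profiles the two-face split `ExitFaceHalfVertexSplit` produces (memo §19's `Ch` up to its constants).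
WHERE IT SITS: in the E-sector «E–E word» of row (C) at level `j+1` the data sides of both slot-derivatives reduce (memo §19 (1)–(4): leaf-04's `EEWordReduced` + this lineage's
`ExitFaceHalfVertexSplit` ∕ `ExitFaceLeftFamily` ∕ `ValueHessianLinearGauge` §4) to `E2`-images of the `Lc`-periodic, bounded, zero-contour-sum profiles `(λ̂_ν ⊙ χ_β)·δ_{b β}`; this
file evaluates the resulting cell pairing. Asserts NO value of Bałaban's tables; discharges NOTHING of (C) ∕ (C)sym ∕ (Q-L) ∕ «T2Shape» ∕ «T2Drift» ∕ (hW, hWall); NEVER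
«G-an2-4 closed» as (CONV-C); NOT D1, NOT `BetaPertH`, NOT continuum, NOT Clay.  2026-08-23; no existing file touched.
-/

noncomputable section

open Finset
open scoped BigOperators
open Literature.MathematicalPhysics.QuantumFieldTheory
open Literature.MathematicalPhysics.QuantumFieldTheory.Balaban1983to89
open Literature.MathematicalPhysics.QuantumFieldTheory.Balaban1983to89.Beta
open ExpKernelCalculus (Site MKer Decays Zl)
open AffineAveraging (box toSite contourSum)
open OneStepResolventKernel (Fib)
open OneStepKernelFamily (KInvStep)
open BalabanStepJetsSucc (E2 wVH decays_E2)
open Summit.QuantumFields.BalabanUV.Beta.BorderedHessian (E2_inl_inl_eq_wΦ)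
open Summit.QuantumFields.BalabanUV.Beta.GAN24.TransverseDictionary (wΦ_symm)
open Summit.QuantumFields.BalabanUV.Beta.AxialDressingRooted (coDressKBmAt decays_coDressKBmAt_KInvStep one_le_of_neZero)
open Summit.QuantumFields.BalabanUV.Beta.GAN24.ValueHessianLinearGauge (contourSum_periodic_mul_exitFace_eq_zero)
open Summit.QuantumFields.BalabanUV.Beta.GAN24.ExitFaceHalfVertexSplit (abs_csawtooth_le)
open Summit.QuantumFields.BalabanUV.Beta.HessKerDressedUnits (unitK)
open Summit.QuantumFields.BalabanUV.Beta.GAN24.StepCovarianceSandwichApply (abs_apply_bdd_le)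
open Summit.QuantumFields.BalabanUV.Beta.GAN24.ValueHessianCellAdjoint (E2_inl_inl_translate sum_box_E2apply_mul_periodic')
open Summit.QuantumFields.BalabanUV.Beta.GAN24.ExchangeE2E2ChannelTools (unitK_inl_inl dressedStep_apply_periodic tsum_E2_unitK_E2_apply_of_contourSum_eq_zero)

namespace Summit.QuantumFields.BalabanUV.Beta.GAN24.ExchangeE2E2ChannelValue

variable {d : ℕ} {Lc : ℕ} [NeZero Lc]

/-! ## §1 The value Hessian and the dressed step kernel on periodic ∕ bounded field-leg data -/

/-- [folklore] `E2` applied to `N•t`-translation-invariant field-leg data is `N•t`-translation-invariant (translation invariance of `E2` + re-indexing; no summability needed). -/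
theorem tsum_E2_apply_translate (j : ℕ) {h : Fin (d + 1) → Site (d + 1) → ℝ} (T : Site (d + 1)) (hh : ∀ b z, h b (z + T) = h b z) (x : Site (d + 1))
    (a : Fin (d + 1)) :
    (∑' z, ∑ b : Fin (d + 1), E2 d Lc j (x + T) z (Sum.inl a) (Sum.inl b) * h b z) = ∑' z, ∑ b : Fin (d + 1), E2 d Lc j x z (Sum.inl a) (Sum.inl b) * h b z := by
  rw [← (Equiv.addRight T).tsum_eq (fun z => ∑ b : Fin (d + 1), E2 d Lc j (x + T) z (Sum.inl a) (Sum.inl b) * h b z)]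
  refine tsum_congr fun z => Finset.sum_congr rfl fun b _ => ?_
  simp only [Equiv.coe_addRight, E2_inl_inl_translate, hh]

/-- [folklore] `E2` applied to bounded field-leg data is uniformly bounded. -/
theorem exists_abs_E2_apply_le (j : ℕ) {h : Fin (d + 1) → Site (d + 1) → ℝ} {B : ℝ} (hhB : ∀ b z, |h b z| ≤ B) :
    ∃ B' : ℝ, ∀ (x : Site (d + 1)) (a : Fin (d + 1)), |∑' z, ∑ b : Fin (d + 1), E2 d Lc j x z (Sum.inl a) (Sum.inl b) * h b z| ≤ B' := by
  obtain ⟨δ, C, hδ, -, hE⟩ := decays_E2 (d := d) (Lc := Lc) j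
  exact ⟨_, fun x a => abs_apply_bdd_le hE hδ hhB x (Sum.inl a)⟩

omit [NeZero Lc] in
/-- [folklore] On field legs the unit-dressed kernel applied to data is `sf²` times the kernel applied to the data. -/
theorem tsum_unitK_apply_eq (sf sm : ℝ) (K : MKer (d + 1) (Fib d)) (h : Fin (d + 1) → Site (d + 1) → ℝ) (x : Site (d + 1)) (a : Fin (d + 1)) :
    (∑' z, ∑ b : Fin (d + 1), unitK sf sm K x z (Sum.inl a) (Sum.inl b) * h b z) = (sf * sf) * ∑' z, ∑ b : Fin (d + 1), K x z (Sum.inl a) (Sum.inl b) * h b z := by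
  rw [← tsum_mul_left]
  refine tsum_congr fun z => ?_
  rw [Finset.mul_sum]
  refine Finset.sum_congr rfl fun b _ => ?_
  rw [unitK_inl_inl]
  ring

/-- [folklore] The unit-dressed step kernel `X̃_j` (in-block root) applied to bounded field-leg data is uniformly bounded on field legs. -/
theorem exists_abs_unitK_apply_le {r : Fin (d + 1) → ℕ} (hr : r ∈ box (d + 1) Lc) (sf sm : ℝ) (j : ℕ) {h : Fin (d + 1) → Site (d + 1) → ℝ} {B : ℝ}
    (hhB : ∀ b z, |h b z| ≤ B) :
    ∃ B' : ℝ, ∀ (x : Site (d + 1)) (a : Fin (d + 1)),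
      |∑' z, ∑ b : Fin (d + 1), unitK sf sm (coDressKBmAt (toSite r) Lc (KInvStep (d := d) Lc j)) x z (Sum.inl a) (Sum.inl b) * h b z| ≤ B' := by
  obtain ⟨δ, C, hδ, -, hG⟩ := decays_coDressKBmAt_KInvStep (d := d) hr j
  refine ⟨|sf * sf| * (((d : ℝ) + 1) * (C * B) * Zl (d + 1) δ), fun x a => ?_⟩
  rw [tsum_unitK_apply_eq, abs_mul]
  exact mul_le_mul_of_nonneg_left (abs_apply_bdd_le hG hδ hhB x (Sum.inl a)) (abs_nonneg _)

/-! ## §2 The channel value on the `Lc`-cell -/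

/-- [folklore] **THE VALUE OF THE E2–X̃–E2 CHANNEL ON THE `Lc`-CELL.** For `Lc`-periodic bounded field-leg profiles `qL`, `qR` with `contourSum Lc qR = 0` (every `j`, in-block root
`toSite r`): `Σ_{x∈cell} Σ_a (Σ'_y Σ_b E2_{j+1}(y,x)_{ba}·qL b y)·(Σ'_z Σ_b X̃_{j+1}(x,z)_{ab}·Σ'_s Σ_{b′} E2_{j+1}(z,s)_{b b′}·qR b′ s) =
sf²·(wVH_{j+1}⁻¹·Σ_{x∈cell} Σ_b qL b x·Σ'_s Σ_{b′} E2_{j+1}(x,s)_{b b′}·qR b′ s)` — cell adjointness `sum_box_E2apply_mul_periodic'` moves the left `E2` onto the right factor, and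
the sandwich through the units `tsum_E2_unitK_E2_apply_of_contourSum_eq_zero` collapses `E2 X̃ E2 qR` to `sf²·wVH⁻¹·E2 qR`. -/
theorem sum_box_E2T_mul_dressedStep_E2_apply {r : Fin (d + 1) → ℕ} (hr : r ∈ box (d + 1) Lc) (sf sm : ℝ) (j : ℕ) {qL qR : Fin (d + 1) → Site (d + 1) → ℝ} {B : ℝ}
    (hqLp : ∀ b y t, qL b (y + (Lc : ℤ) • t) = qL b y) (hqRp : ∀ b y t, qR b (y + (Lc : ℤ) • t) = qR b y) (hqLB : ∀ b y, |qL b y| ≤ B) (hqRB : ∀ b y, |qR b y| ≤ B)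
    (hqR0 : ∀ κ y, contourSum Lc qR κ y = 0) :
    ∑ x ∈ box (d + 1) Lc, ∑ a : Fin (d + 1),
        (∑' y, ∑ b : Fin (d + 1), E2 d Lc (j + 1) y (toSite x) (Sum.inl b) (Sum.inl a) * qL b y) *
          ∑' z, ∑ b : Fin (d + 1), unitK sf sm (coDressKBmAt (toSite r) Lc (KInvStep (d := d) Lc (j + 1))) (toSite x) z (Sum.inl a) (Sum.inl b) *
            ∑' s, ∑ b' : Fin (d + 1), E2 d Lc (j + 1) z s (Sum.inl b) (Sum.inl b') * qR b' s =
      (sf * sf) * ((wVH d Lc (j + 1))⁻¹ *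
        ∑ x ∈ box (d + 1) Lc, ∑ b : Fin (d + 1), qL b (toSite x) * ∑' s, ∑ b' : Fin (d + 1), E2 d Lc (j + 1) (toSite x) s (Sum.inl b) (Sum.inl b') * qR b' s) := by
  -- the right factor `Y a x := (X̃ (E2 qR))(a, x)`: periodic and bounded; the inner `E2 qR` is periodic and bounded
  set g : Fin (d + 1) → Site (d + 1) → ℝ := fun b z => ∑' s, ∑ b' : Fin (d + 1), E2 d Lc (j + 1) z s (Sum.inl b) (Sum.inl b') * qR b' s with hgdef
  have hgp : ∀ b z t, g b (z + (Lc : ℤ) • t) = g b z := fun b z t => tsum_E2_apply_translate (j + 1) ((Lc : ℤ) • t) (fun b' s => hqRp b' s t) z b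
  obtain ⟨Bg, hgB⟩ := exists_abs_E2_apply_le (d := d) (Lc := Lc) (j + 1) hqRB
  have hgB' : ∀ b z, |g b z| ≤ Bg := fun b z => hgB z b
  set Y : Fin (d + 1) → Site (d + 1) → ℝ :=
    fun a x => ∑' z, ∑ b : Fin (d + 1), unitK sf sm (coDressKBmAt (toSite r) Lc (KInvStep (d := d) Lc (j + 1))) x z (Sum.inl a) (Sum.inl b) * g b z with hYdef
  have hYp : ∀ a x t, Y a (x + (Lc : ℤ) • t) = Y a x := fun a x t => dressedStep_apply_periodic sf sm (j + 1) hgp (Sum.inl a) x t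
  obtain ⟨BY, hYB⟩ := exists_abs_unitK_apply_le hr sf sm (j + 1) hgB'
  have hYB' : ∀ a x, |Y a x| ≤ BY := fun a x => hYB x a
  -- a common bound
  have hqLB' : ∀ b y, |qL b y| ≤ max B BY := fun b y => (hqLB b y).trans (le_max_left _ _)
  have hYB'' : ∀ a x, |Y a x| ≤ max B BY := fun a x => (hYB' a x).trans (le_max_right _ _)
  -- symmetry of `E2` on field legs: the left factor is `(E2 qL)(a, x)`
  have hsym : ∀ (x : Fin (d + 1) → ℕ) (a : Fin (d + 1)), (∑' y, ∑ b : Fin (d + 1), E2 d Lc (j + 1) y (toSite x) (Sum.inl b) (Sum.inl a) * qL b y) =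
      ∑' y, ∑ b : Fin (d + 1), E2 d Lc (j + 1) (toSite x) y (Sum.inl a) (Sum.inl b) * qL b y := by
    intro x a
    refine tsum_congr fun y => Finset.sum_congr rfl fun b _ => ?_
    rw [E2_inl_inl_eq_wΦ, E2_inl_inl_eq_wΦ, wΦ_symm]
    congr 2
    abel
  have hL : ∀ (x : Fin (d + 1) → ℕ) (a : Fin (d + 1)),
      (∑' y, ∑ b : Fin (d + 1), E2 d Lc (j + 1) y (toSite x) (Sum.inl b) (Sum.inl a) * qL b y) *
          (∑' z, ∑ b : Fin (d + 1), unitK sf sm (coDressKBmAt (toSite r) Lc (KInvStep (d := d) Lc (j + 1))) (toSite x) z (Sum.inl a) (Sum.inl b) *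
            ∑' s, ∑ b' : Fin (d + 1), E2 d Lc (j + 1) z s (Sum.inl b) (Sum.inl b') * qR b' s) =
        (∑' y, ∑ b : Fin (d + 1), E2 d Lc (j + 1) (toSite x) y (Sum.inl a) (Sum.inl b) * qL b y) * Y a (toSite x) := by
    intro x a
    rw [hsym]
  simp_rw [hL]
  rw [sum_box_E2apply_mul_periodic' (Lc := Lc) (j + 1) hqLp hYp hqLB' hYB'']
  -- the inner pairing is the sandwich through the units
  have hin : ∀ (x : Fin (d + 1) → ℕ) (b : Fin (d + 1)),
      (∑' w, ∑ a : Fin (d + 1), E2 d Lc (j + 1) (toSite x) w (Sum.inl b) (Sum.inl a) * Y a w) = (sf * sf) * ((wVH d Lc (j + 1))⁻¹ * g b (toSite x)) :=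
    fun x b => tsum_E2_unitK_E2_apply_of_contourSum_eq_zero hr sf sm j hqRB hqR0 (toSite x) b
  simp_rw [hin]
  rw [Finset.mul_sum, Finset.mul_sum]
  refine Finset.sum_congr rfl fun x _ => ?_
  rw [Finset.mul_sum, Finset.mul_sum]
  refine Finset.sum_congr rfl fun b _ => ?_
  ring

/-! ## §3 The channel on the «sawtooth × exit-face» profiles of the two-face split -/

omit [NeZero Lc] in
/-- [folklore] The «(shifted) sawtooth × exit face» profile `b y ↦ [b = α]·(c·(y_μ % Lc − e))·χ_α(y)` is `Lc`-periodic. -/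
theorem sawFace_translate (c e : ℝ) (μ α b : Fin (d + 1)) (y t : Site (d + 1)) :
    (if b = α then (c * ((((y + (Lc : ℤ) • t) μ % (Lc : ℤ) : ℤ) : ℝ) - e)) * (if (y + (Lc : ℤ) • t) α % (Lc : ℤ) = (Lc : ℤ) - 1 then (1 : ℝ) else 0) else 0) =
      (if b = α then (c * (((y μ % (Lc : ℤ) : ℤ) : ℝ) - e)) * (if y α % (Lc : ℤ) = (Lc : ℤ) - 1 then (1 : ℝ) else 0) else 0) := by
  simp only [Pi.add_apply, Pi.smul_apply, smul_eq_mul, Int.add_mul_emod_self_left]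

omit [NeZero Lc] in
/-- [folklore] The «sawtooth × exit face» profile is bounded by `|c|·(Lc + |e|)` (`1 ≤ Lc`). -/
theorem abs_sawFace_le (hLc : 1 ≤ Lc) (c e : ℝ) (μ α b : Fin (d + 1)) (y : Site (d + 1)) :
    |(if b = α then (c * (((y μ % (Lc : ℤ) : ℤ) : ℝ) - e)) * (if y α % (Lc : ℤ) = (Lc : ℤ) - 1 then (1 : ℝ) else 0) else 0)| ≤ |c| * ((Lc : ℝ) + |e|) := by
  have hs := abs_csawtooth_le (d := d) hLc e μ y
  rw [zero_mul, add_zero] at hs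
  have h0 : 0 ≤ |c| * ((Lc : ℝ) + |e|) := by positivity
  split_ifs
  · rw [mul_one, abs_mul]
    exact mul_le_mul_of_nonneg_left hs (abs_nonneg c)
  · rwa [mul_zero, abs_zero]
  · rwa [abs_zero]

/-- [folklore] **THE CENTRED «SAWTOOTH × EXIT FACE» PROFILE HAS ZERO `Lc`-BLOCK CONTOUR SUMS** (`ν ≠ β`; offset `e = (Lc − 1)∕2` makes the sawtooth zero-mean over a period —
D1 §4 `contourSum_periodic_mul_exitFace_eq_zero` + Gauss' `Σ_{t<Lc} t = Lc(Lc−1)∕2`). -/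
theorem contourSum_csawFace_eq_zero (c : ℝ) {ν β : Fin (d + 1)} (hνβ : ν ≠ β) (κ : Fin (d + 1)) (y : Site (d + 1)) :
    contourSum Lc (fun b (s : Site (d + 1)) =>
      if b = β then (c * (((s ν % (Lc : ℤ) : ℤ) : ℝ) - ((Lc : ℝ) - 1) / 2)) * (if s β % (Lc : ℤ) = (Lc : ℤ) - 1 then (1 : ℝ) else 0) else 0) κ y = 0 := by
  have hLc : 1 ≤ Lc := one_le_of_neZero Lc
  refine contourSum_periodic_mul_exitFace_eq_zero (ψ := fun u : ℤ => c * (((u % (Lc : ℤ) : ℤ) : ℝ) - ((Lc : ℝ) - 1) / 2)) (fun t k => ?_) ?_ hνβ κ y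
  · simp only [Int.add_mul_emod_self_left]
  · have e : ∀ t ∈ Finset.range Lc, (fun u : ℤ => c * (((u % (Lc : ℤ) : ℤ) : ℝ) - ((Lc : ℝ) - 1) / 2)) (t : ℤ) = c * ((t : ℝ) - ((Lc : ℝ) - 1) / 2) := by
      intro t ht
      have ht' : (t : ℤ) < (Lc : ℤ) := by exact_mod_cast Finset.mem_range.1 ht
      show c * ((((t : ℤ) % (Lc : ℤ) : ℤ) : ℝ) - ((Lc : ℝ) - 1) / 2) = c * ((t : ℝ) - ((Lc : ℝ) - 1) / 2)
      rw [Int.emod_eq_of_lt (by positivity) ht', Int.cast_natCast]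
    rw [Finset.sum_congr rfl e, ← Finset.mul_sum, Finset.sum_sub_distrib, Finset.sum_const, Finset.card_range, nsmul_eq_mul]
    have hG : (∑ i ∈ Finset.range Lc, (i : ℝ)) * 2 = (Lc : ℝ) * ((Lc : ℝ) - 1) := by
      have h := congrArg (Nat.cast : ℕ → ℝ) (Finset.sum_range_id_mul_two Lc)
      push_cast [Nat.cast_sub hLc] at h
      exact h
    have : (∑ i ∈ Finset.range Lc, (i : ℝ)) - (Lc : ℝ) * (((Lc : ℝ) - 1) / 2) = 0 := by linarith
    rw [this, mul_zero]

omit [NeZero Lc] in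
/-- [folklore] Collapsing the leg sum against a one-leg profile (right factor). -/
theorem sum_mul_ite_leg (f : Fin (d + 1) → ℝ) (α : Fin (d + 1)) (φ : ℝ) : (∑ b : Fin (d + 1), f b * (if b = α then φ else 0)) = f α * φ := by
  rw [Finset.sum_eq_single α (fun b _ hb => by rw [if_neg hb, mul_zero]) (fun h => absurd (Finset.mem_univ α) h), if_pos rfl]

omit [NeZero Lc] in
/-- [folklore] Collapsing the leg sum against a one-leg profile (left factor). -/
theorem sum_ite_mul_leg (g : Fin (d + 1) → ℝ) (α : Fin (d + 1)) (φ : ℝ) : (∑ b : Fin (d + 1), (if b = α then φ else 0) * g b) = φ * g α := by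
  rw [Finset.sum_eq_single α (fun b _ hb => by rw [if_neg hb, zero_mul]) (fun h => absurd (Finset.mem_univ α) h), if_pos rfl]

/-- [folklore] **THE E2–X̃–E2 CHANNEL ON THE TWO-FACE SPLIT's PROFILES** (memo §19's `Ch`, up to its constants; every `j`, in-block root, amplitudes `cL cR`, left offset `eL`,
`ν ≠ β`): with `λL(y) = cL·(y_μ % Lc − eL)`, `λR(s) = cR·(s_ν % Lc − (Lc−1)∕2)` and the exit faces `χ_α`, `χ_β`,
`Σ_{x∈cell} Σ_a (Σ'_y E2_{j+1}(y,x)_{αa}·λL(y)χ_α(y)) · (Σ'_z Σ_b X̃_{j+1}(x,z)_{ab}·Σ'_s E2_{j+1}(z,s)_{bβ}·λR(s)χ_β(s))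
 = sf²·(wVH_{j+1}⁻¹·Σ_{x∈cell} λL(x)χ_α(x)·Σ'_s E2_{j+1}(x,s)_{αβ}·λR(s)χ_β(s))` — §2 on the profiles `[b=α]λLχ_α`, `[b=β]λRχ_β` (periodic, bounded, the right one with
zero contour sums by `contourSum_csawFace_eq_zero`). These are exactly the `E2`-pieces the split `ExitFaceHalfVertexSplit.faceface_e3OfK_split(_fst)` produces on the two legs
(the left offset is free: `E2` kills constants, D1 §3). -/
theorem sum_box_channel_sawFace {r : Fin (d + 1) → ℕ} (hr : r ∈ box (d + 1) Lc) (sf sm : ℝ) (j : ℕ) (cL eL cR : ℝ) (μ α : Fin (d + 1)) {ν β : Fin (d + 1)}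
    (hνβ : ν ≠ β) :
    ∑ x ∈ box (d + 1) Lc, ∑ a : Fin (d + 1),
        (∑' y, E2 d Lc (j + 1) y (toSite x) (Sum.inl α) (Sum.inl a) *
            ((cL * (((y μ % (Lc : ℤ) : ℤ) : ℝ) - eL)) * (if y α % (Lc : ℤ) = (Lc : ℤ) - 1 then (1 : ℝ) else 0))) *
          ∑' z, ∑ b : Fin (d + 1), unitK sf sm (coDressKBmAt (toSite r) Lc (KInvStep (d := d) Lc (j + 1))) (toSite x) z (Sum.inl a) (Sum.inl b) *
            ∑' s, E2 d Lc (j + 1) z s (Sum.inl b) (Sum.inl β) *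
              ((cR * (((s ν % (Lc : ℤ) : ℤ) : ℝ) - ((Lc : ℝ) - 1) / 2)) * (if s β % (Lc : ℤ) = (Lc : ℤ) - 1 then (1 : ℝ) else 0)) =
      (sf * sf) * ((wVH d Lc (j + 1))⁻¹ *
        ∑ x ∈ box (d + 1) Lc, ((cL * (((toSite x μ % (Lc : ℤ) : ℤ) : ℝ) - eL)) * (if toSite x α % (Lc : ℤ) = (Lc : ℤ) - 1 then (1 : ℝ) else 0)) *
          ∑' s, E2 d Lc (j + 1) (toSite x) s (Sum.inl α) (Sum.inl β) *
            ((cR * (((s ν % (Lc : ℤ) : ℤ) : ℝ) - ((Lc : ℝ) - 1) / 2)) * (if s β % (Lc : ℤ) = (Lc : ℤ) - 1 then (1 : ℝ) else 0))) := by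
  have hLc : 1 ≤ Lc := one_le_of_neZero Lc
  have hBL : ∀ (b : Fin (d + 1)) (y : Site (d + 1)),
      |(if b = α then (cL * (((y μ % (Lc : ℤ) : ℤ) : ℝ) - eL)) * (if y α % (Lc : ℤ) = (Lc : ℤ) - 1 then (1 : ℝ) else 0) else 0)| ≤
        max (|cL| * ((Lc : ℝ) + |eL|)) (|cR| * ((Lc : ℝ) + |((Lc : ℝ) - 1) / 2|)) :=
    fun b y => (abs_sawFace_le hLc cL eL μ α b y).trans (le_max_left _ _)
  have hBR : ∀ (b : Fin (d + 1)) (s : Site (d + 1)),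
      |(if b = β then (cR * (((s ν % (Lc : ℤ) : ℤ) : ℝ) - ((Lc : ℝ) - 1) / 2)) * (if s β % (Lc : ℤ) = (Lc : ℤ) - 1 then (1 : ℝ) else 0) else 0)| ≤
        max (|cL| * ((Lc : ℝ) + |eL|)) (|cR| * ((Lc : ℝ) + |((Lc : ℝ) - 1) / 2|)) :=
    fun b s => (abs_sawFace_le hLc cR (((Lc : ℝ) - 1) / 2) ν β b s).trans (le_max_right _ _)
  have h := sum_box_E2T_mul_dressedStep_E2_apply hr sf sm j
    (qL := fun b (y : Site (d + 1)) => if b = α then (cL * (((y μ % (Lc : ℤ) : ℤ) : ℝ) - eL)) * (if y α % (Lc : ℤ) = (Lc : ℤ) - 1 then (1 : ℝ) else 0) else 0)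
    (qR := fun b (s : Site (d + 1)) =>
      if b = β then (cR * (((s ν % (Lc : ℤ) : ℤ) : ℝ) - ((Lc : ℝ) - 1) / 2)) * (if s β % (Lc : ℤ) = (Lc : ℤ) - 1 then (1 : ℝ) else 0) else 0)
    (fun b y t => sawFace_translate cL eL μ α b y t) (fun b s t => sawFace_translate cR (((Lc : ℝ) - 1) / 2) ν β b s t) hBL hBR
    (fun κ y => contourSum_csawFace_eq_zero cR hνβ κ y)
  simp only [sum_mul_ite_leg, sum_ite_mul_leg] at h
  exact h

end Summit.QuantumFields.BalabanUV.Beta.GAN24.ExchangeE2E2ChannelValue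

end
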